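import Summits.QuantumFields.BalabanUV.T4Continuum.Spine.NE1p.DressedSmallFieldOnCoresSlot
import Summits.QuantumFields.BalabanUV.T4Continuum.Spine.NE1p.DressedOutputAnalytic

/-!
# T⁴ programme, spine estimate NE1′ (node O3b/H2) — THE SOURCE-ANALYTIC AND PARAMETRIC SMALL-FIELD ENDs WITH (B1a)
# DISCHARGED: holomorphy + the (2.41) envelope in ANY parameter (N0n), the linear response and the (w5) regeneration
# constant (N0j) fired with row NE5's `TermHistExpLinear` exactly as N0p §3 fires the attached part and the μ-part — for
# exp-linear families, for (2.14)-cores with term-dependent polymer families and a LETTER budget, and at the substrate's slot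

Cell `pub-balaban`, sub-cell `t4`, BINDER-OWNERS row NE1′; NE1′ formalisation crew, unit `b2b-balaban-t4-ne1p-formalise-leaf-03`
(LEAF PROVER 03, generation 12); crew row S33 ∕ DAG N29zzd of `t4/formal/NE1p/LEAVES.md` (INTENT journal l.18431, BOOKED typer R-T123 (vi) l.18500; X-read X147).  ADDITIVE — imports the
owner's N0r `Spine/NE1p/DressedSmallFieldOnCoresSlot` (p228506; → N0q → N0p → N0o → N0m∕N0j, row NE5's `B13Term*`, the substrate's
`SubstrateActivities`) and N0n `Spine/NE1p/DressedOutputAnalytic` (p220982; → N0j) ONLY; THEOREMS ONLY (0 def, 0 `def … : Prop`,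
0 cite); nothing of those modules is restated — their declarations are used BY NAME.

WHY THIS FILE.  N0p §3 DISCHARGED the per-polymer (E1)∕(E2) binders `hhol`∕`hm` from row NE5's structural shape
`T4InputCauchyRateTermwise.TermHistExpLinear` (N0p §2 `differentiableOn_act_of_terms` ∕ `norm_act_le_of_terms`) for TWO of the
owner's small-field ENDs — the attached part and the μ-part — and N0q (letter budget) ∕ N0r (term-dependent `dom`, the substrate's
slot with `hact` by `rfl`) carried those two further.  The owner's OTHER small-field ENDs — holomorphy of the dressed output in ANY
complex parameter with the (2.41) envelope (N0n `analytic_and_bounded_locE_param`; at `P := ℂ × B`, `U := ball 0 μ₁ ×ˢ W` the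
JOINT (source, background) face = the analyticity half of (w1) for regenerated generations), the LINEAR RESPONSE (N0j
`muDeriv_locE_le`, the face feeding `DressedSmallFieldAllowance`) and the (w5) REGENERATION CONSTANT (N0j `regenPart_locE_le`) —
carry (E1)∕(E2) DISPLAYED in every applier in the tree (N0o §1, S24∕S25, W24∕W26∕W36).  This file takes them through the same
three junctions: §1 (kernel; N0p §1∕§2's proofs VERBATIM for a table map `hc : P → Hist` on a set `S` of ANY complex normed
space `P` — N0p's is `P = ℂ`) (E1)∕(E2) for finite sums of exp-linear terms read along `hc`; §2 (kernel; geometry FED from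
`G : B13Resummation.Geometry D Cube` as N0o does) `analytic_and_bounded_locE_param_of_expLinear` (N0n ONCE BY NAME, §1 for
(E1)∕(E2)), `muDeriv_locE_le_of_expLinear` ∕ `regenPart_locE_le_of_expLinear` (N0j ONCE each, N0p §2 for (E1)∕(E2)) — binders
left = N0p §3's list (`hexp`, `hcurve`∕`hK`∕`hR`, `hscale`∕`hact` = (B1b)'s indexing, a.e. read-out bounds `hN`, the (2.38)-shape
`hL3` of the parameter masses = binder (B3) = GAPS G-ne9p2-5, UNPRINTED, shared with NE9, the clauses with `5r₁ ≤ b₅`); §3 (kernel;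
N0r §2's pattern — cores `𝔊 k i X : BiCore P (dom k i) Op (β k i) (α k i)` with TERM-DEPENDENT polymer families, operator letters +
room, `hexp := termHistExpLinear_termAt`, SOURCE pencil `h₀ + s • v` on `‖s‖ < μ₁`, (B3) as N0q's letter budget `hM3` via
`norm_integral_coreDensity_le` termwise) `analytic_and_bounded_locE_of_coresAt_pencil_mass` ∕ `muDeriv_locE_le_of_coresAt_pencil_mass`;
§4 (kernel; N0r §3's pattern — the substrate's letters `ℓ : ∀ Z j, CoreLetters P Op 𝒴 dom Jc V Z j`, term index `Pol × J`, `hact`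
BY `rfl`) `analytic_and_bounded_locE_of_actOfLetters` ∕ `muDeriv_locE_le_of_actOfLetters`: the dressed output of the slot activities
`s ↦ E[Σ_{p ∈ terms Z} actOfLetters ℓ p.1 p.2 o (h₀ + s • v)](X₀)` is complex differentiable on `‖s‖ < μ₁`, bounded there by
`e·ν·c₁·K₀²·A·e^{−r₁ d(X₀)}`, and its source derivative on `‖s‖ ≤ μ₀ < μ₁` is `≤ 2·(…)∕(μ₁ − μ₀)` — binders LITERALLY those of
N0r's `muPart_locE_le_of_actOfLetters` minus the window point's `h0`.

HONEST FRAMING (the typer's rider R-T123 (vi), verbatim): «(B1a)'s (E1)∕(E2) half for the source-analytic, parametric, response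
and regeneration ENDs discharged BY NAME through row NE5's structural SHAPE `TermHistExpLinear` exactly as N0p did for the attached∕μ
parts — a relocation onto the exp-linear FORMAT hypothesis whose identification with Bałaban's (2.14) is the substrate's DISPLAYED
reading, NOT claimed; (B1b)'s residue (`terms`∕`emb`∕`hscale`), (B3) = `hM3` (G-ne9p2-5 UNPRINTED, shared with NE9), the clause
SHAPES and `hO`∕`hH` stay DISPLAYED; 0 binders instantiated on Bałaban's densities; no wall item; wall v1.7 (T4-DAG v43) does NOT
move».  The operator-letter blocks are rows NE2∕NE3's Gaussian data, displayed as row NE5 displays them; the cores ∕ letters are the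
cell's typed FORMAT of [Balaban1988RGII] (2.14) and the substrate's displayed inputs, not Bałaban's functions; (2.14) p. 15, (2.38)
p. 20, (2.41) p. 21 and p. 15's analyticity sentence are LOCI (TYPE∕CONTEXT) quoted in the imported modules with their tags; no
numeral of print; ABSOLUTE RULE honoured ([folklore] kernel lemmas only; no disputed step of the audited manuscripts enters as a
fact).  NE1′ ⇐ the named binders — NOT proved, NOT printed; spine PROVED 0∕9; count 9 unchanged.  Rung (B)+1 on ONE finite
four-torus — NOT infinite volume, NOT a mass gap, NOT OS on ℝ⁴, NOT Clay.  HONEST DEPENDENCY: continuum YM on T⁴ ⇐ BetaPertH ∧ nine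
spine estimates (0/9 proved); BetaPertH ⇐ (D1) ∧ (D4) ∧ CAP+tail; G-an2-4 gates asym, D1 and NE2/3/4.
-/

noncomputable section

namespace Summit.QuantumFields.BalabanUV.T4Continuum.NE1p.DressedSourceAnalyticOnCores

open Metric Set Complex MeasureTheory
open scoped BigOperators
open Literature.MathematicalPhysics.QuantumFieldTheory.Balaban1983to89 (LocDomainSys)
open Literature.MathematicalPhysics.QuantumFieldTheory.Balaban1983to89.T4OutputRate (Carriers)
open Literature.MathematicalPhysics.QuantumFieldTheory.Balaban1983to89.B13Resummation (locE Geometry)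
open Literature.MathematicalPhysics.QuantumFieldTheory.Balaban1983to89.T4InputCauchyRateTermwise (TermHistExpLinear
  differentiable_integral_mul_cexp_clm norm_integral_mul_cexp_clm_le)
open Summit.QuantumFields.BalabanUV.T4Continuum.B13HistMeasurable (MeasPotFrame B13HistM)
open Summit.QuantumFields.BalabanUV.T4Continuum.B13TermParamGaussianBi (BiCore)
open Summit.QuantumFields.BalabanUV.T4Continuum.SubstrateActivities (CoreLetters coreOf actOfLetters)
open Summit.QuantumFields.BalabanUV.T4Continuum.NE1p.DressedSmallFieldPencil (muDeriv_locE_le regenPart_locE_le)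
open Summit.QuantumFields.BalabanUV.T4Continuum.NE1p.DressedOutputAnalytic (analytic_and_bounded_locE_param)
open Summit.QuantumFields.BalabanUV.T4Continuum.NE1p.DressedSmallFieldOnCores (differentiableOn_act_of_terms
  norm_act_le_of_terms pencil_mem_ballClass norm_pencil_le)
open Summit.QuantumFields.BalabanUV.T4Continuum.NE1p.DressedSmallFieldOnCoresMass (norm_integral_coreDensity_le)
open Summit.QuantumFields.BalabanUV.T4Continuum.NE1p.DressedSmallFieldOnCoresSlot (termHistExpLinear_termAt)

/-! ## §1 (E1)∕(E2) FOR EXP-LINEAR TERMS READ ALONG A TABLE MAP FROM ANY COMPLEX PARAMETER SPACE -/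

section Param
variable {C : Carriers} {Op Hist : Type*} [NormedAddCommGroup Hist] [NormedSpace ℂ Hist] {ι : Type*}
  {K : ℕ → (ℕ → ℝ) → C.BgB → Set (Op × Hist)} {T : ℕ → ι → Op → Hist → C.Dom → ℂ}
  {W : Set (ℕ → ℝ)} {α : ℕ → ι → Type*} [∀ k i, MeasurableSpace (α k i)] {μ : ∀ k i, Op → C.Dom → Measure (α k i)}
  {Φ : ∀ k i, Op → C.Dom → α k i → ℂ} {Λ : ∀ k i, Op → C.Dom → α k i → (Hist →L[ℂ] ℂ)}
  {P : Type*} [NormedAddCommGroup P] [NormedSpace ℂ P]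

/-- **(E1) PER TERM ALONG A TABLE MAP FROM ANY PARAMETER SPACE** (kernel; N0p `differentiableOn_term_curve` VERBATIM for
`hc : P → Hist` on `S ⊆ P`: the exp-linear integral is ENTIRE in the table, `differentiable_integral_mul_cexp_clm`). [folklore] -/
theorem differentiableOn_term_param (hexp : TermHistExpLinear K T W μ Φ Λ) {k : ℕ} {g : ℕ → ℝ} (hg : g ∈ W)
    {U : C.BgB} {o : Op} {hc : P → Hist} {S : Set P} (hcurve : DifferentiableOn ℂ hc S)
    (hK : ∀ p ∈ S, (o, hc p) ∈ K k g U) {X : C.Dom} (hX : C.scale X = k) (i : ι) :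
    DifferentiableOn ℂ (fun p => T k i o (hc p) X) S := by
  intro p hp
  obtain ⟨hΦ, hΛm, ⟨N, hN⟩, -⟩ := hexp k g hg U (o, hc p) (hK p hp) X hX i
  have hF := differentiable_integral_mul_cexp_clm hΦ hΛm hN
  refine ((hF _).comp_differentiableWithinAt p (hcurve p hp)).congr (fun p' hp' => ?_) ?_
  · exact (hexp k g hg U (o, hc p') (hK p' hp') X hX i).2.2.2
  · exact (hexp k g hg U (o, hc p) (hK p hp) X hX i).2.2.2

omit [NormedAddCommGroup P] [NormedSpace ℂ P] in
/-- **(E2) PER TERM ALONG A TABLE MAP FROM ANY PARAMETER SPACE** (kernel; N0p `norm_term_curve_le` VERBATIM for `hc : P → Hist`: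
`‖T k i o (hc p) X‖ ≤ (∫‖Φ k i o X‖)·e^{N·R₀}` on `S`, `norm_integral_mul_cexp_clm_le`). [folklore] -/
theorem norm_term_param_le (hexp : TermHistExpLinear K T W μ Φ Λ) {k : ℕ} {g : ℕ → ℝ} (hg : g ∈ W) {U : C.BgB}
    {o : Op} {hc : P → Hist} {S : Set P} (hK : ∀ p ∈ S, (o, hc p) ∈ K k g U) {R₀ : ℝ} (hR : ∀ p ∈ S, ‖hc p‖ ≤ R₀)
    {X : C.Dom} (hX : C.scale X = k) (i : ι) {N : ℝ} (hN0 : 0 ≤ N) (hN : ∀ᵐ a ∂μ k i o X, ‖Λ k i o X a‖ ≤ N)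
    {p : P} (hp : p ∈ S) :
    ‖T k i o (hc p) X‖ ≤ (∫ a, ‖Φ k i o X a‖ ∂μ k i o X) * Real.exp (N * R₀) := by
  obtain ⟨hΦ, -, -, hrep⟩ := hexp k g hg U (o, hc p) (hK p hp) X hX i
  have hrep' : T k i o (hc p) X = ∫ a, Φ k i o X a * cexp (Λ k i o X a (hc p)) ∂μ k i o X := hrep
  rw [hrep']
  exact (norm_integral_mul_cexp_clm_le hΦ hN (hc p)).trans (mul_le_mul_of_nonneg_left
    (Real.exp_le_exp.2 (mul_le_mul_of_nonneg_left (hR p hp) hN0)) (integral_nonneg fun _ => norm_nonneg _))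

variable {Dom : Type*} {emb : Dom → C.Dom} {terms : Dom → Finset ι} {act : P → Dom → ℂ}

/-- **(E1) FOR THE ACTIVITIES, ANY PARAMETER SPACE** (kernel; §1 summed — N0p `differentiableOn_act_of_terms` for `P`). [folklore] -/
theorem differentiableOn_act_of_terms_param (hexp : TermHistExpLinear K T W μ Φ Λ) {k : ℕ} {g : ℕ → ℝ} (hg : g ∈ W)
    {U : C.BgB} {o : Op} {hc : P → Hist} {S : Set P} (hcurve : DifferentiableOn ℂ hc S)
    (hK : ∀ p ∈ S, (o, hc p) ∈ K k g U) (hscale : ∀ Z, C.scale (emb Z) = k)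
    (hact : ∀ p ∈ S, ∀ Z, act p Z = ∑ i ∈ terms Z, T k i o (hc p) (emb Z)) (Z : Dom) :
    DifferentiableOn ℂ (fun p => act p Z) S := by
  have h : DifferentiableOn ℂ (fun p => ∑ i ∈ terms Z, T k i o (hc p) (emb Z)) S :=
    DifferentiableOn.fun_sum fun i _ => differentiableOn_term_param hexp hg hcurve hK (hscale Z) i
  exact h.congr fun p hp => hact p hp Z

omit [NormedAddCommGroup P] [NormedSpace ℂ P] in
/-- **(E2) FOR THE ACTIVITIES, ANY PARAMETER SPACE** (kernel; §1 summed — N0p `norm_act_le_of_terms` for `P`): on `S`,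
`‖act p Z‖ ≤ Σ_{i ∈ terms Z} (∫‖Φ k i o (emb Z)‖)·e^{N Z i·R₀}` — N0j's parameter-free majorant. [folklore] -/
theorem norm_act_le_of_terms_param (hexp : TermHistExpLinear K T W μ Φ Λ) {k : ℕ} {g : ℕ → ℝ} (hg : g ∈ W) {U : C.BgB}
    {o : Op} {hc : P → Hist} {S : Set P} (hK : ∀ p ∈ S, (o, hc p) ∈ K k g U) {R₀ : ℝ} (hR : ∀ p ∈ S, ‖hc p‖ ≤ R₀)
    (hscale : ∀ Z, C.scale (emb Z) = k) (hact : ∀ p ∈ S, ∀ Z, act p Z = ∑ i ∈ terms Z, T k i o (hc p) (emb Z))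
    {N : Dom → ι → ℝ} (hN0 : ∀ Z i, 0 ≤ N Z i) (hN : ∀ Z, ∀ i ∈ terms Z, ∀ᵐ a ∂μ k i o (emb Z), ‖Λ k i o (emb Z) a‖ ≤ N Z i)
    {p : P} (hp : p ∈ S) (Z : Dom) :
    ‖act p Z‖ ≤ ∑ i ∈ terms Z, (∫ a, ‖Φ k i o (emb Z) a‖ ∂μ k i o (emb Z)) * Real.exp (N Z i * R₀) := by
  rw [hact p hp Z]
  exact (norm_sum_le _ _).trans
    (Finset.sum_le_sum fun i hi => norm_term_param_le hexp hg hK hR (hscale Z) i (hN0 Z i) (hN Z i hi) hp)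

/-! ## §2 THE PARAMETRIC ∕ SOURCE-ANALYTIC ENDs OF N0n AND N0j WITH (B1a) DISCHARGED, OVER A `B13Resummation.Geometry` -/

variable (D : LocDomainSys) {Cube : Type} [DecidableEq Cube] (G : Geometry D Cube)

open Classical in
/-- **THE DRESSED OUTPUT IS HOLOMORPHIC IN ANY PARAMETER IN WHICH THE TABLE IS, AND BOUNDED BY THE (2.41) ENVELOPE — (B1a)
DISCHARGED** (kernel; N0n `analytic_and_bounded_locE_param` ONCE BY NAME, geometry fed from `G` as in N0o, (E1)∕(E2) by §1 along
`hc : P → Hist` complex differentiable on an OPEN `S` keeping `(o, hc p)` in the class with table radius `R₀`).  Binders left: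
`hexp`; `hS`∕`hcurve`∕`hK`∕`hR`; `hscale`∕`hact`; `hN`; the (2.38)-shape `hL3` at the constant `A`; clauses, `5r₁ ≤ b₅`.  At
`P := ℂ × B`, `S := ball 0 μ₁ ×ˢ W` this is the JOINT (source, background) face; at `P := ℂ`, `S := ball 0 μ₁` holomorphy in
the source with the μ-uniform (2.41) envelope (N0o `differentiableOn_locE_geom` ∕ `norm_locE_le_geom`'s content). [folklore] -/
theorem analytic_and_bounded_locE_param_of_expLinear (hexp : TermHistExpLinear K T W μ Φ Λ) {k : ℕ} {g : ℕ → ℝ}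
    (hg : g ∈ W) {U : C.BgB} {o : Op} {hc : P → Hist} {S : Set P} (hS : IsOpen S) {R₀ : ℝ}
    (hcurve : DifferentiableOn ℂ hc S) (hK : ∀ p ∈ S, (o, hc p) ∈ K k g U) (hR : ∀ p ∈ S, ‖hc p‖ ≤ R₀)
    {emb : D.Dom → C.Dom} (hscale : ∀ Z, C.scale (emb Z) = k) {terms : D.Dom → Finset ι} {act : P → D.Dom → ℂ}
    (hact : ∀ p ∈ S, ∀ Z, act p Z = ∑ i ∈ terms Z, T k i o (hc p) (emb Z)) {N : D.Dom → ι → ℝ}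
    (hN0 : ∀ Z i, 0 ≤ N Z i) (hN : ∀ Z, ∀ i ∈ terms Z, ∀ᵐ a ∂μ k i o (emb Z), ‖Λ k i o (emb Z) a‖ ≤ N Z i)
    {A R r₁ b₅ : ℝ} {X₀ : D.Dom} (hA : 0 ≤ A) (hr₁ : 0 ≤ r₁) (hb : r₁ * 5 ≤ b₅)
    (hrate : r₁ + 2 * G.κ₀ + 2 ≤ R) (hsmall : A * Real.exp (b₅ + 1) * G.K₀ * G.ν * G.c₁ ≤ 1) (hL3 : ∀ Z, G.cubes Z ⊆ G.cubes X₀ →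
      ∑ i ∈ terms Z, (∫ a, ‖Φ k i o (emb Z) a‖ ∂μ k i o (emb Z)) * Real.exp (N Z i * R₀) ≤ A * Real.exp (-(R * D.dj Z))) :
    DifferentiableOn ℂ (fun p => locE G.ι G.cubes (act p) (G.cubes X₀)) S ∧
      ∀ p ∈ S, ‖locE G.ι G.cubes (act p) (G.cubes X₀)‖ ≤
        Real.exp 1 * G.ν * G.c₁ * G.K₀ ^ 2 * A * Real.exp (-(r₁ * D.dj X₀)) := by
  haveI : Std.Refl G.ι := ⟨G.ι_refl⟩
  haveI : Std.Symm G.ι := ⟨G.ι_symm⟩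
  exact analytic_and_bounded_locE_param G.ι hS G.loc G.reach_le D.dj_nonneg hA G.K₀_nonneg G.c₁_nonneg G.ν_nonneg
    G.κ₀_nonneg hr₁ (by norm_num) hb G.ineq126 G.volBound (G.ineq227 X₀) hrate hsmall (G.cubes_nonempty X₀)
    (fun Z _ => differentiableOn_act_of_terms_param hexp hg hcurve hK hscale hact Z)
    (fun _ hp Z _ => norm_act_le_of_terms_param hexp hg hK hR hscale hact hN0 hN hp Z) hL3

open Classical in
/-- **LINEAR RESPONSE OF THE DRESSED SMALL-FIELD OUTPUT, (B1a) DISCHARGED** (kernel; N0j `muDeriv_locE_le` ONCE BY NAME,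
geometry fed from `G`, (E1)∕(E2) by N0p §2 along a SOURCE curve `hc : ℂ → Hist` on `‖s‖ < μ₁`): for `‖sμ‖ ≤ μ₀ < μ₁`,
`‖∂_s E[act s](X₀)|_{sμ}‖ ≤ 2·(e·ν·c₁·K₀²·A·e^{−r₁ d(X₀)})∕(μ₁ − μ₀)`. [folklore] -/
theorem muDeriv_locE_le_of_expLinear (hexp : TermHistExpLinear K T W μ Φ Λ) {k : ℕ} {g : ℕ → ℝ} (hg : g ∈ W)
    {U : C.BgB} {o : Op} {hc : ℂ → Hist} {μ₁ R₀ : ℝ} (hcurve : DifferentiableOn ℂ hc (ball (0 : ℂ) μ₁))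
    (hK : ∀ s ∈ ball (0 : ℂ) μ₁, (o, hc s) ∈ K k g U) (hR : ∀ s ∈ ball (0 : ℂ) μ₁, ‖hc s‖ ≤ R₀)
    {emb : D.Dom → C.Dom} (hscale : ∀ Z, C.scale (emb Z) = k) {terms : D.Dom → Finset ι} {act : ℂ → D.Dom → ℂ}
    (hact : ∀ s ∈ ball (0 : ℂ) μ₁, ∀ Z, act s Z = ∑ i ∈ terms Z, T k i o (hc s) (emb Z)) {N : D.Dom → ι → ℝ}
    (hN0 : ∀ Z i, 0 ≤ N Z i) (hN : ∀ Z, ∀ i ∈ terms Z, ∀ᵐ a ∂μ k i o (emb Z), ‖Λ k i o (emb Z) a‖ ≤ N Z i)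
    {A R r₁ b₅ μ₀ : ℝ} {X₀ : D.Dom} {sμ : ℂ} (hA : 0 ≤ A) (hr₁ : 0 ≤ r₁) (hb : r₁ * 5 ≤ b₅)
    (hrate : r₁ + 2 * G.κ₀ + 2 ≤ R) (hsmall : A * Real.exp (b₅ + 1) * G.K₀ * G.ν * G.c₁ ≤ 1) (hL3 : ∀ Z, G.cubes Z ⊆ G.cubes X₀ →
      ∑ i ∈ terms Z, (∫ a, ‖Φ k i o (emb Z) a‖ ∂μ k i o (emb Z)) * Real.exp (N Z i * R₀) ≤ A * Real.exp (-(R * D.dj Z)))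
    (h01 : μ₀ < μ₁) (hμ : ‖sμ‖ ≤ μ₀) :
    ‖deriv (fun s => locE G.ι G.cubes (act s) (G.cubes X₀)) sμ‖ ≤
      2 * (Real.exp 1 * G.ν * G.c₁ * G.K₀ ^ 2 * A * Real.exp (-(r₁ * D.dj X₀))) / (μ₁ - μ₀) := by
  haveI : Std.Refl G.ι := ⟨G.ι_refl⟩
  haveI : Std.Symm G.ι := ⟨G.ι_symm⟩
  exact muDeriv_locE_le G.ι G.loc G.reach_le D.dj_nonneg hA G.K₀_nonneg G.c₁_nonneg G.ν_nonneg G.κ₀_nonneg hr₁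
    (by norm_num) hb G.ineq126 G.volBound (G.ineq227 X₀) hrate hsmall (G.cubes_nonempty X₀)
    (fun Z _ => differentiableOn_act_of_terms hexp hg hcurve hK hscale hact Z)
    (fun _ hs Z _ => norm_act_le_of_terms hexp hg hK hR hscale hact hN0 hN hs Z) hL3 h01 hμ

open Classical in
/-- **THE (w5) REGENERATION CONSTANT WITH DECAY, (B1a) DISCHARGED** (kernel; N0j `regenPart_locE_le` ONCE BY NAME, geometry fed
from `G`, (E1)∕(E2) by N0p §2 along a STRENGTH curve `hc : ℂ → Hist` on `‖s‖ < ϱ`, `1 < ϱ`):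
`‖E[act 1](X₀) − E[act 0](X₀)‖ ≤ (e·ν·c₁·K₀²·A·e^{−r₁ d(X₀)})∕(ϱ − 1)`. [folklore] -/
theorem regenPart_locE_le_of_expLinear (hexp : TermHistExpLinear K T W μ Φ Λ) {k : ℕ} {g : ℕ → ℝ} (hg : g ∈ W)
    {U : C.BgB} {o : Op} {hc : ℂ → Hist} {ϱ R₀ : ℝ} (hcurve : DifferentiableOn ℂ hc (ball (0 : ℂ) ϱ))
    (hK : ∀ s ∈ ball (0 : ℂ) ϱ, (o, hc s) ∈ K k g U) (hR : ∀ s ∈ ball (0 : ℂ) ϱ, ‖hc s‖ ≤ R₀)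
    {emb : D.Dom → C.Dom} (hscale : ∀ Z, C.scale (emb Z) = k) {terms : D.Dom → Finset ι} {act : ℂ → D.Dom → ℂ}
    (hact : ∀ s ∈ ball (0 : ℂ) ϱ, ∀ Z, act s Z = ∑ i ∈ terms Z, T k i o (hc s) (emb Z)) {N : D.Dom → ι → ℝ}
    (hN0 : ∀ Z i, 0 ≤ N Z i) (hN : ∀ Z, ∀ i ∈ terms Z, ∀ᵐ a ∂μ k i o (emb Z), ‖Λ k i o (emb Z) a‖ ≤ N Z i)
    {A R r₁ b₅ : ℝ} {X₀ : D.Dom} (hA : 0 ≤ A) (hr₁ : 0 ≤ r₁) (hb : r₁ * 5 ≤ b₅)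
    (hrate : r₁ + 2 * G.κ₀ + 2 ≤ R) (hsmall : A * Real.exp (b₅ + 1) * G.K₀ * G.ν * G.c₁ ≤ 1) (hL3 : ∀ Z, G.cubes Z ⊆ G.cubes X₀ →
      ∑ i ∈ terms Z, (∫ a, ‖Φ k i o (emb Z) a‖ ∂μ k i o (emb Z)) * Real.exp (N Z i * R₀) ≤ A * Real.exp (-(R * D.dj Z)))
    (hϱ : 1 < ϱ) :
    ‖locE G.ι G.cubes (act 1) (G.cubes X₀) - locE G.ι G.cubes (act 0) (G.cubes X₀)‖ ≤
      Real.exp 1 * G.ν * G.c₁ * G.K₀ ^ 2 * A * Real.exp (-(r₁ * D.dj X₀)) / (ϱ - 1) := by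
  haveI : Std.Refl G.ι := ⟨G.ι_refl⟩
  haveI : Std.Symm G.ι := ⟨G.ι_symm⟩
  exact regenPart_locE_le G.ι G.loc G.reach_le D.dj_nonneg hA G.K₀_nonneg G.c₁_nonneg G.ν_nonneg G.κ₀_nonneg hr₁
    (by norm_num) hb G.ineq126 G.volBound (G.ineq227 X₀) hrate hsmall (G.cubes_nonempty X₀)
    (fun Z _ => differentiableOn_act_of_terms hexp hg hcurve hK hscale hact Z)
    (fun _ hs Z _ => norm_act_le_of_terms hexp hg hK hR hscale hact hN0 hN hs Z) hL3 hϱ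

end Param

/-! ## §3 ON CORES WITH TERM-DEPENDENT POLYMER FAMILIES, SOURCE PENCIL `h₀ + s • v`, (B3) AS N0q's LETTER BUDGET -/

section Dep
variable {C : Carriers} {P : MeasPotFrame C} {Op : Type*} [NormedAddCommGroup Op] [NormedSpace ℂ Op] {ι : Type*}
  {𝒴 : ℕ → ι → Type*} {dom : ∀ k i, 𝒴 k i → C.Dom} {β : ℕ → ι → Type*} [∀ k i, MeasurableSpace (β k i)]
  {α : ℕ → ι → Type*} [∀ k i, NormedAddCommGroup (α k i)] [∀ k i, InnerProductSpace ℝ (α k i)]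
  [∀ k i, FiniteDimensional ℝ (α k i)] [∀ k i, MeasurableSpace (α k i)] [∀ k i, BorelSpace (α k i)]
variable (D : LocDomainSys) {Cube : Type} [DecidableEq Cube] (G : Geometry D Cube)

open Classical in
/-- **HOLOMORPHY IN THE SOURCE AND THE μ-UNIFORM (2.41) ENVELOPE FOR CORES WITH TERM-DEPENDENT POLYMER FAMILIES, (B3) AS A LETTER
BUDGET** (kernel; §2 `analytic_and_bounded_locE_param_of_expLinear` at `P = ℂ`, `S = ball 0 μ₁`, `hexp := termHistExpLinear_termAt`
(N0r §1), pencil data by N0p's `pencil_mem_ballClass` ∕ `norm_pencil_le`, read-out bounds by the cores' `N₁`, `hL3` from N0q's letter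
budget **`hM3`** via `norm_integral_coreDensity_le` termwise).  Binders = N0r's `muPart_locE_le_of_coresAt_pencil_mass` WITHOUT the
window point.  Conclusion: `s ↦ E[act s](X₀)` is complex differentiable on `‖s‖ < μ₁` and `≤ e·ν·c₁·K₀²·A·e^{−r₁ d(X₀)}` there.
[folklore] -/
theorem analytic_and_bounded_locE_of_coresAt_pencil_mass {W : Set (ℕ → ℝ)}
    {ctr : ℕ → (ℕ → ℝ) → C.BgB → Op × B13HistM P} {ROp RHist R' : ℕ → ℝ}
    (𝔊 : ∀ k i, C.Dom → BiCore P (dom k i) Op (β k i) (α k i)) {mq bq N₀ : ℕ → ι → C.Dom → ℝ} (hroom : ∀ k, ROp k < R' k)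
    (hm : ∀ k, ∀ g ∈ W, ∀ (U : C.BgB) (X : C.Dom), C.scale X = k → ∀ i, 0 < mq k i X)
    (hN : ∀ k, ∀ g ∈ W, ∀ (U : C.BgB) (X : C.Dom), C.scale X = k → ∀ i,
      (∀ o ∈ ball (ctr k g U).1 (R' k), AEStronglyMeasurable ((𝔊 k i X).N o) (𝔊 k i X).lam) ∧
      (∀ p, DifferentiableOn ℂ (fun o => (𝔊 k i X).N o p) (ball (ctr k g U).1 (R' k))) ∧
      (∀ o ∈ ball (ctr k g U).1 (R' k), ∀ p, ‖(𝔊 k i X).N o p‖ ≤ N₀ k i X))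
    (hq : ∀ k, ∀ g ∈ W, ∀ (U : C.BgB) (X : C.Dom), C.scale X = k → ∀ i,
      (∀ o ∈ ball (ctr k g U).1 (R' k),
        AEStronglyMeasurable (Function.uncurry ((𝔊 k i X).q o)) ((𝔊 k i X).lam.prod volume)) ∧
      (∀ p v, DifferentiableOn ℂ (fun o => (𝔊 k i X).q o p v) (ball (ctr k g U).1 (R' k))) ∧
      (∀ o ∈ ball (ctr k g U).1 (R' k), ∀ p v, mq k i X * ‖v‖ ^ 2 - bq k i X ≤ ((𝔊 k i X).q o p v).re))
    {k : ℕ} {g : ℕ → ℝ} (hg : g ∈ W) {U : C.BgB} {o : Op} {h₀ v : B13HistM P} {μ₁ : ℝ}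
    (hO : ‖o - (ctr k g U).1‖ ≤ ROp k) (hH : ‖h₀ - (ctr k g U).2‖ + μ₁ * ‖v‖ ≤ RHist k)
    {emb : D.Dom → C.Dom} (hscale : ∀ Z, C.scale (emb Z) = k) {terms : D.Dom → Finset ι} {act : ℂ → D.Dom → ℂ}
    (hact : ∀ s ∈ ball (0 : ℂ) μ₁, ∀ Z, act s Z = ∑ i ∈ terms Z, (𝔊 k i (emb Z)).termAt o (h₀ + s • v))
    {A R r₁ b₅ : ℝ} {X₀ : D.Dom} (hA : 0 ≤ A) (hr₁ : 0 ≤ r₁) (hb : r₁ * 5 ≤ b₅)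
    (hrate : r₁ + 2 * G.κ₀ + 2 ≤ R) (hsmall : A * Real.exp (b₅ + 1) * G.K₀ * G.ν * G.c₁ ≤ 1) (hM3 : ∀ Z, G.cubes Z ⊆ G.cubes X₀ →
      ∑ i ∈ terms Z, (𝔊 k i (emb Z)).lam.real univ * ((𝔊 k i (emb Z)).wB * N₀ k i (emb Z) *
          Real.exp (bq k i (emb Z))) * (Real.pi / (mq k i (emb Z) / 2)) ^ (Module.finrank ℝ (α k i) / 2 : ℝ) *
        Real.exp ((𝔊 k i (emb Z)).N₁ * (‖h₀‖ + μ₁ * ‖v‖)) ≤ A * Real.exp (-(R * D.dj Z))) :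
    DifferentiableOn ℂ (fun s => locE G.ι G.cubes (act s) (G.cubes X₀)) (ball (0 : ℂ) μ₁) ∧
      ∀ s ∈ ball (0 : ℂ) μ₁, ‖locE G.ι G.cubes (act s) (G.cubes X₀)‖ ≤
        Real.exp 1 * G.ν * G.c₁ * G.K₀ ^ 2 * A * Real.exp (-(r₁ * D.dj X₀)) := by
  have ho : o ∈ ball (ctr k g U).1 (R' k) := mem_ball.2 (by rw [dist_eq_norm]; exact lt_of_le_of_lt hO (hroom k))
  refine analytic_and_bounded_locE_param_of_expLinear D G (termHistExpLinear_termAt 𝔊 hroom hm hN hq) hg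
    (hc := fun s => h₀ + s • v) isOpen_ball
    ((differentiable_const h₀).add (differentiable_id.smul_const v)).differentiableOn
    (fun _ hs => pencil_mem_ballClass hO hH hs) (fun _ hs => norm_pencil_le hs) hscale hact
    (fun Z i => (𝔊 k i (emb Z)).N₁_nonneg)
    (fun Z i _ => Filter.Eventually.of_forall fun z => (𝔊 k i (emb Z)).norm_readOut_le z.1 z.2)
    hA hr₁ hb hrate hsmall (fun Z hZ => le_trans ?_ (hM3 Z hZ))
  refine Finset.sum_le_sum fun i _ => mul_le_mul_of_nonneg_right ?_ (Real.exp_pos _).le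
  simpa only [one_mul] using norm_integral_coreDensity_le (𝔊 k i (emb Z)) (hm k g hg U (emb Z) (hscale Z) i)
    (hN k g hg U (emb Z) (hscale Z) i).2.2 (hq k g hg U (emb Z) (hscale Z) i).2.2 ho

open Classical in
/-- **LINEAR RESPONSE FOR CORES WITH TERM-DEPENDENT POLYMER FAMILIES, (B3) AS A LETTER BUDGET** (kernel; §2
`muDeriv_locE_le_of_expLinear` with `hexp := termHistExpLinear_termAt`, pencil data and `hL3` as above): for `‖sμ‖ ≤ μ₀ < μ₁`,
`‖∂_s E[act s](X₀)|_{sμ}‖ ≤ 2·(e·ν·c₁·K₀²·A·e^{−r₁ d(X₀)})∕(μ₁ − μ₀)`. [folklore] -/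
theorem muDeriv_locE_le_of_coresAt_pencil_mass {W : Set (ℕ → ℝ)}
    {ctr : ℕ → (ℕ → ℝ) → C.BgB → Op × B13HistM P} {ROp RHist R' : ℕ → ℝ}
    (𝔊 : ∀ k i, C.Dom → BiCore P (dom k i) Op (β k i) (α k i)) {mq bq N₀ : ℕ → ι → C.Dom → ℝ} (hroom : ∀ k, ROp k < R' k)
    (hm : ∀ k, ∀ g ∈ W, ∀ (U : C.BgB) (X : C.Dom), C.scale X = k → ∀ i, 0 < mq k i X)
    (hN : ∀ k, ∀ g ∈ W, ∀ (U : C.BgB) (X : C.Dom), C.scale X = k → ∀ i,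
      (∀ o ∈ ball (ctr k g U).1 (R' k), AEStronglyMeasurable ((𝔊 k i X).N o) (𝔊 k i X).lam) ∧
      (∀ p, DifferentiableOn ℂ (fun o => (𝔊 k i X).N o p) (ball (ctr k g U).1 (R' k))) ∧
      (∀ o ∈ ball (ctr k g U).1 (R' k), ∀ p, ‖(𝔊 k i X).N o p‖ ≤ N₀ k i X))
    (hq : ∀ k, ∀ g ∈ W, ∀ (U : C.BgB) (X : C.Dom), C.scale X = k → ∀ i,
      (∀ o ∈ ball (ctr k g U).1 (R' k),
        AEStronglyMeasurable (Function.uncurry ((𝔊 k i X).q o)) ((𝔊 k i X).lam.prod volume)) ∧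
      (∀ p v, DifferentiableOn ℂ (fun o => (𝔊 k i X).q o p v) (ball (ctr k g U).1 (R' k))) ∧
      (∀ o ∈ ball (ctr k g U).1 (R' k), ∀ p v, mq k i X * ‖v‖ ^ 2 - bq k i X ≤ ((𝔊 k i X).q o p v).re))
    {k : ℕ} {g : ℕ → ℝ} (hg : g ∈ W) {U : C.BgB} {o : Op} {h₀ v : B13HistM P} {μ₁ : ℝ}
    (hO : ‖o - (ctr k g U).1‖ ≤ ROp k) (hH : ‖h₀ - (ctr k g U).2‖ + μ₁ * ‖v‖ ≤ RHist k)
    {emb : D.Dom → C.Dom} (hscale : ∀ Z, C.scale (emb Z) = k) {terms : D.Dom → Finset ι} {act : ℂ → D.Dom → ℂ}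
    (hact : ∀ s ∈ ball (0 : ℂ) μ₁, ∀ Z, act s Z = ∑ i ∈ terms Z, (𝔊 k i (emb Z)).termAt o (h₀ + s • v))
    {A R r₁ b₅ μ₀ : ℝ} {X₀ : D.Dom} {sμ : ℂ} (hA : 0 ≤ A) (hr₁ : 0 ≤ r₁) (hb : r₁ * 5 ≤ b₅)
    (hrate : r₁ + 2 * G.κ₀ + 2 ≤ R) (hsmall : A * Real.exp (b₅ + 1) * G.K₀ * G.ν * G.c₁ ≤ 1) (hM3 : ∀ Z, G.cubes Z ⊆ G.cubes X₀ →
      ∑ i ∈ terms Z, (𝔊 k i (emb Z)).lam.real univ * ((𝔊 k i (emb Z)).wB * N₀ k i (emb Z) *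
          Real.exp (bq k i (emb Z))) * (Real.pi / (mq k i (emb Z) / 2)) ^ (Module.finrank ℝ (α k i) / 2 : ℝ) *
        Real.exp ((𝔊 k i (emb Z)).N₁ * (‖h₀‖ + μ₁ * ‖v‖)) ≤ A * Real.exp (-(R * D.dj Z)))
    (h01 : μ₀ < μ₁) (hμ : ‖sμ‖ ≤ μ₀) :
    ‖deriv (fun s => locE G.ι G.cubes (act s) (G.cubes X₀)) sμ‖ ≤
      2 * (Real.exp 1 * G.ν * G.c₁ * G.K₀ ^ 2 * A * Real.exp (-(r₁ * D.dj X₀))) / (μ₁ - μ₀) := by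
  have ho : o ∈ ball (ctr k g U).1 (R' k) := mem_ball.2 (by rw [dist_eq_norm]; exact lt_of_le_of_lt hO (hroom k))
  refine muDeriv_locE_le_of_expLinear D G (termHistExpLinear_termAt 𝔊 hroom hm hN hq) hg (hc := fun s => h₀ + s • v)
    ((differentiable_const h₀).add (differentiable_id.smul_const v)).differentiableOn
    (fun _ hs => pencil_mem_ballClass hO hH hs) (fun _ hs => norm_pencil_le hs) hscale hact
    (fun Z i => (𝔊 k i (emb Z)).N₁_nonneg)
    (fun Z i _ => Filter.Eventually.of_forall fun z => (𝔊 k i (emb Z)).norm_readOut_le z.1 z.2)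
    hA hr₁ hb hrate hsmall (fun Z hZ => le_trans ?_ (hM3 Z hZ)) h01 hμ
  refine Finset.sum_le_sum fun i _ => mul_le_mul_of_nonneg_right ?_ (Real.exp_pos _).le
  simpa only [one_mul] using norm_integral_coreDensity_le (𝔊 k i (emb Z)) (hm k g hg U (emb Z) (hscale Z) i)
    (hN k g hg U (emb Z) (hscale Z) i).2.2 (hq k g hg U (emb Z) (hscale Z) i).2.2 ho

end Dep

/-! ## §4 AT THE SUBSTRATE'S LETTERS: the slot activities `actOfLetters ℓ` along the source pencil — `hact` BY `rfl` -/

section Slot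
variable {C : Carriers} (P : MeasPotFrame C) (Op : Type*) [NormedAddCommGroup Op] [NormedSpace ℂ Op] {Pol J : Type*}
  (𝒴 : Pol → J → Type) [∀ Z j, Fintype (𝒴 Z j)] (dom : ∀ Z j, 𝒴 Z j → C.Dom)
  (Jc : Pol → J → Type) [∀ Z j, Fintype (Jc Z j)]
  (V : Pol → J → Type) [∀ Z j, NormedAddCommGroup (V Z j)] [∀ Z j, InnerProductSpace ℝ (V Z j)]
  [∀ Z j, MeasurableSpace (V Z j)] [∀ Z j, BorelSpace (V Z j)] [∀ Z j, FiniteDimensional ℝ (V Z j)]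
variable (D : LocDomainSys) {Cube : Type} [DecidableEq Cube] (G : Geometry D Cube)

open Classical in
/-- **HOLOMORPHY IN THE SOURCE AND THE μ-UNIFORM (2.41) ENVELOPE OF THE DRESSED OUTPUT OF THE SUBSTRATE'S SLOT ACTIVITIES**
(kernel; §3 at the term index `Pol × J`, `𝔊 k p X := coreOf ℓ p.1 p.2`, dressed activity of the polymer `Z` := `Σ_{p ∈ terms Z}
actOfLetters ℓ p.1 p.2 o (h₀ + s • v)` — `hact` BY `rfl`).  Binders = N0r's `muPart_locE_le_of_actOfLetters` without the window
point: `hroom`; the substrate's Gaussian letters on the open operator ball (`hm`∕`hN`∕`hq`); `hO`∕`hH` at the source radius `μ₁`;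
(B1b)'s residue `terms`∕`emb`∕`hscale`; `G`; clauses; (B3) = `hM3`.  Conclusion: `s ↦ E[Σ actOfLetters … o (h₀ + s • v)](X₀)` is
complex differentiable on `‖s‖ < μ₁` and bounded there by `e·ν·c₁·K₀²·A·e^{−r₁ d(X₀)}`. [folklore] -/
theorem analytic_and_bounded_locE_of_actOfLetters {W : Set (ℕ → ℝ)} {ctr : ℕ → (ℕ → ℝ) → C.BgB → Op × B13HistM P}
    {ROp RHist R' : ℕ → ℝ} (ℓ : ∀ Z j, CoreLetters P Op 𝒴 dom Jc V Z j) {mq bq N₀ : ℕ → Pol × J → C.Dom → ℝ}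
    (hroom : ∀ k, ROp k < R' k) (hm : ∀ k, ∀ g ∈ W, ∀ (U : C.BgB) (X : C.Dom), C.scale X = k → ∀ p, 0 < mq k p X)
    (hN : ∀ k, ∀ g ∈ W, ∀ (U : C.BgB) (X : C.Dom), C.scale X = k → ∀ p : Pol × J,
      (∀ o ∈ ball (ctr k g U).1 (R' k),
        AEStronglyMeasurable ((ℓ p.1 p.2).N o) (coreOf P Op 𝒴 dom Jc V ℓ p.1 p.2).lam) ∧
      (∀ a, DifferentiableOn ℂ (fun o => (ℓ p.1 p.2).N o a) (ball (ctr k g U).1 (R' k))) ∧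
      (∀ o ∈ ball (ctr k g U).1 (R' k), ∀ a, ‖(ℓ p.1 p.2).N o a‖ ≤ N₀ k p X))
    (hq : ∀ k, ∀ g ∈ W, ∀ (U : C.BgB) (X : C.Dom), C.scale X = k → ∀ p : Pol × J,
      (∀ o ∈ ball (ctr k g U).1 (R' k),
        AEStronglyMeasurable (Function.uncurry ((ℓ p.1 p.2).q o))
          ((coreOf P Op 𝒴 dom Jc V ℓ p.1 p.2).lam.prod volume)) ∧
      (∀ a v, DifferentiableOn ℂ (fun o => (ℓ p.1 p.2).q o a v) (ball (ctr k g U).1 (R' k))) ∧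
      (∀ o ∈ ball (ctr k g U).1 (R' k), ∀ a v, mq k p X * ‖v‖ ^ 2 - bq k p X ≤ ((ℓ p.1 p.2).q o a v).re))
    {k : ℕ} {g : ℕ → ℝ} (hg : g ∈ W) {U : C.BgB} {o : Op} {h₀ v : B13HistM P} {μ₁ : ℝ}
    (hO : ‖o - (ctr k g U).1‖ ≤ ROp k) (hH : ‖h₀ - (ctr k g U).2‖ + μ₁ * ‖v‖ ≤ RHist k)
    {emb : D.Dom → C.Dom} (hscale : ∀ Z, C.scale (emb Z) = k) (terms : D.Dom → Finset (Pol × J))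
    {A R r₁ b₅ : ℝ} {X₀ : D.Dom} (hA : 0 ≤ A) (hr₁ : 0 ≤ r₁) (hb : r₁ * 5 ≤ b₅)
    (hrate : r₁ + 2 * G.κ₀ + 2 ≤ R) (hsmall : A * Real.exp (b₅ + 1) * G.K₀ * G.ν * G.c₁ ≤ 1) (hM3 : ∀ Z, G.cubes Z ⊆ G.cubes X₀ →
      ∑ p ∈ terms Z, (coreOf P Op 𝒴 dom Jc V ℓ p.1 p.2).lam.real univ *
          ((coreOf P Op 𝒴 dom Jc V ℓ p.1 p.2).wB * N₀ k p (emb Z) * Real.exp (bq k p (emb Z))) *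
          (Real.pi / (mq k p (emb Z) / 2)) ^ (Module.finrank ℝ (V p.1 p.2) / 2 : ℝ) *
        Real.exp ((coreOf P Op 𝒴 dom Jc V ℓ p.1 p.2).N₁ * (‖h₀‖ + μ₁ * ‖v‖)) ≤ A * Real.exp (-(R * D.dj Z))) :
    DifferentiableOn ℂ (fun s => locE G.ι G.cubes
        (fun Z => ∑ p ∈ terms Z, actOfLetters P Op 𝒴 dom Jc V ℓ p.1 p.2 o (h₀ + s • v)) (G.cubes X₀)) (ball (0 : ℂ) μ₁) ∧
      ∀ s ∈ ball (0 : ℂ) μ₁, ‖locE G.ι G.cubes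
          (fun Z => ∑ p ∈ terms Z, actOfLetters P Op 𝒴 dom Jc V ℓ p.1 p.2 o (h₀ + s • v)) (G.cubes X₀)‖ ≤
        Real.exp 1 * G.ν * G.c₁ * G.K₀ ^ 2 * A * Real.exp (-(r₁ * D.dj X₀)) :=
  analytic_and_bounded_locE_of_coresAt_pencil_mass D G (ι := Pol × J)
    (fun (_ : ℕ) (p : Pol × J) (_ : C.Dom) => coreOf P Op 𝒴 dom Jc V ℓ p.1 p.2) hroom hm hN hq hg hO hH hscale
    (terms := terms) (act := fun s Z => ∑ p ∈ terms Z, actOfLetters P Op 𝒴 dom Jc V ℓ p.1 p.2 o (h₀ + s • v))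
    (fun _ _ _ => rfl) hA hr₁ hb hrate hsmall hM3

open Classical in
/-- **LINEAR RESPONSE OF THE DRESSED OUTPUT OF THE SUBSTRATE'S SLOT ACTIVITIES** (kernel; §3 `muDeriv_locE_le_of_coresAt_pencil_mass`
at the term index `Pol × J`, `hact` BY `rfl`): for `‖sμ‖ ≤ μ₀ < μ₁` the source derivative of `s ↦ E[Σ actOfLetters … o (h₀ + s •
v)](X₀)` at `sμ` is `≤ 2·(e·ν·c₁·K₀²·A·e^{−r₁ d(X₀)})∕(μ₁ − μ₀)`. [folklore] -/
theorem muDeriv_locE_le_of_actOfLetters {W : Set (ℕ → ℝ)} {ctr : ℕ → (ℕ → ℝ) → C.BgB → Op × B13HistM P}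
    {ROp RHist R' : ℕ → ℝ} (ℓ : ∀ Z j, CoreLetters P Op 𝒴 dom Jc V Z j) {mq bq N₀ : ℕ → Pol × J → C.Dom → ℝ}
    (hroom : ∀ k, ROp k < R' k) (hm : ∀ k, ∀ g ∈ W, ∀ (U : C.BgB) (X : C.Dom), C.scale X = k → ∀ p, 0 < mq k p X)
    (hN : ∀ k, ∀ g ∈ W, ∀ (U : C.BgB) (X : C.Dom), C.scale X = k → ∀ p : Pol × J,
      (∀ o ∈ ball (ctr k g U).1 (R' k),
        AEStronglyMeasurable ((ℓ p.1 p.2).N o) (coreOf P Op 𝒴 dom Jc V ℓ p.1 p.2).lam) ∧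
      (∀ a, DifferentiableOn ℂ (fun o => (ℓ p.1 p.2).N o a) (ball (ctr k g U).1 (R' k))) ∧
      (∀ o ∈ ball (ctr k g U).1 (R' k), ∀ a, ‖(ℓ p.1 p.2).N o a‖ ≤ N₀ k p X))
    (hq : ∀ k, ∀ g ∈ W, ∀ (U : C.BgB) (X : C.Dom), C.scale X = k → ∀ p : Pol × J,
      (∀ o ∈ ball (ctr k g U).1 (R' k),
        AEStronglyMeasurable (Function.uncurry ((ℓ p.1 p.2).q o))
          ((coreOf P Op 𝒴 dom Jc V ℓ p.1 p.2).lam.prod volume)) ∧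
      (∀ a v, DifferentiableOn ℂ (fun o => (ℓ p.1 p.2).q o a v) (ball (ctr k g U).1 (R' k))) ∧
      (∀ o ∈ ball (ctr k g U).1 (R' k), ∀ a v, mq k p X * ‖v‖ ^ 2 - bq k p X ≤ ((ℓ p.1 p.2).q o a v).re))
    {k : ℕ} {g : ℕ → ℝ} (hg : g ∈ W) {U : C.BgB} {o : Op} {h₀ v : B13HistM P} {μ₁ : ℝ}
    (hO : ‖o - (ctr k g U).1‖ ≤ ROp k) (hH : ‖h₀ - (ctr k g U).2‖ + μ₁ * ‖v‖ ≤ RHist k)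
    {emb : D.Dom → C.Dom} (hscale : ∀ Z, C.scale (emb Z) = k) (terms : D.Dom → Finset (Pol × J))
    {A R r₁ b₅ μ₀ : ℝ} {X₀ : D.Dom} {sμ : ℂ} (hA : 0 ≤ A) (hr₁ : 0 ≤ r₁) (hb : r₁ * 5 ≤ b₅)
    (hrate : r₁ + 2 * G.κ₀ + 2 ≤ R) (hsmall : A * Real.exp (b₅ + 1) * G.K₀ * G.ν * G.c₁ ≤ 1) (hM3 : ∀ Z, G.cubes Z ⊆ G.cubes X₀ →
      ∑ p ∈ terms Z, (coreOf P Op 𝒴 dom Jc V ℓ p.1 p.2).lam.real univ *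
          ((coreOf P Op 𝒴 dom Jc V ℓ p.1 p.2).wB * N₀ k p (emb Z) * Real.exp (bq k p (emb Z))) *
          (Real.pi / (mq k p (emb Z) / 2)) ^ (Module.finrank ℝ (V p.1 p.2) / 2 : ℝ) *
        Real.exp ((coreOf P Op 𝒴 dom Jc V ℓ p.1 p.2).N₁ * (‖h₀‖ + μ₁ * ‖v‖)) ≤ A * Real.exp (-(R * D.dj Z)))
    (h01 : μ₀ < μ₁) (hμ : ‖sμ‖ ≤ μ₀) :
    ‖deriv (fun s => locE G.ι G.cubes
        (fun Z => ∑ p ∈ terms Z, actOfLetters P Op 𝒴 dom Jc V ℓ p.1 p.2 o (h₀ + s • v)) (G.cubes X₀)) sμ‖ ≤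
      2 * (Real.exp 1 * G.ν * G.c₁ * G.K₀ ^ 2 * A * Real.exp (-(r₁ * D.dj X₀))) / (μ₁ - μ₀) :=
  muDeriv_locE_le_of_coresAt_pencil_mass D G (ι := Pol × J)
    (fun (_ : ℕ) (p : Pol × J) (_ : C.Dom) => coreOf P Op 𝒴 dom Jc V ℓ p.1 p.2) hroom hm hN hq hg hO hH hscale
    (terms := terms) (act := fun s Z => ∑ p ∈ terms Z, actOfLetters P Op 𝒴 dom Jc V ℓ p.1 p.2 o (h₀ + s • v))
    (fun _ _ _ => rfl) hA hr₁ hb hrate hsmall hM3 h01 hμ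

end Slot

end Summit.QuantumFields.BalabanUV.T4Continuum.NE1p.DressedSourceAnalyticOnCores

end
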